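import Mathlib
import Summits.SmoothPoincare4.SmoothPoincare4.Theorems.SoloInformedFusionOneDiscGroup
import Summits.SmoothPoincare4.SmoothPoincare4.Theorems.SoloInformedNashStipsiczGroup

/-!
# All four Nash–Stipsicz 2-knot groups are fusion-number-one disc groups

Solo artefact (unit `solo-SmoothPoincare4-informed`), calibration for the fusion-number-one instance
problem of the Schoenflies-ball conjunct.

Nash–Stipsicz (arXiv:1103.5571, Prop. 4.2) compute the groups of the 2-knots
`K²_{pq} = (D⁴, D(p,q)₁) ∪ (D⁴, D(p,q)₂)‾ ⊂ S⁴` assembled from the two fusion-number-one ribbon discs of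
the ribbon knots `K(p,q)` as one-relator groups `⟨x, y | r_{pq}⟩`, the relator depending only on the
parities of `p` and `q`:

* `p, q` even:  `r_ee = x y x y⁻¹ x⁻¹ y x y x⁻¹ y⁻¹`,
* `p, q` odd:   `r_oo = x y x y x⁻¹ y⁻¹ x y⁻¹ x⁻¹ y⁻¹` (= `NashStipsicz.nsRelator`),
* `p` odd, `q` even: `r_oe = x y x y⁻¹ x⁻¹ y⁻¹ x y x⁻¹ y⁻¹`,
* `p` even, `q` odd: `r_eo = x y x y x⁻¹ y x y⁻¹ x⁻¹ y⁻¹`.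

A fusion-number-one ribbon disc with band word `w` has group `Γ(w) = ⟨x₁, x₂ | x₁ = w x₂ w⁻¹⟩`
(`FusionOne.DiscGroup w`).  We certify that **every one of the four Nash–Stipsicz groups is such a
disc group**: `r_oe` and `r_oo` are literally `x · Γ-relator⁻¹ · x⁻¹` for `w = [y, x] = y x y⁻¹ x⁻¹`
resp. `w = y x y x⁻¹`, and `r_ee`, `r_eo` become so after the free-group automorphism `y ↦ y⁻¹`
(band words `y⁻¹ x y x⁻¹` resp. `y⁻¹ x y⁻¹ x⁻¹`).  So the parity of `p` selects the band word, the
parity of `q` the orientation of `y`, and in every case the one-relator presentation of the 2-knot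
group carries no visible trace of the second ("small") 2-handle of the complement: abstractly it is
the group of a single ribbon disc complement.  (The odd–odd case is
`NashStipsicz.nsGroupMulEquivDiscGroup` in `SoloInformedNashStipsiczDisc`; here we do the other three
and provide the general lemmas.)

## Contents
* `NashStipsicz.normalClosure_conj_inv_singleton` — `⟪g r⁻¹ g⁻¹⟫ = ⟪r⟫` in any group;
* `NashStipsicz.equivDiscGroupOfEq` — a relator of the shape `x (Γ-relator of w)⁻¹ x⁻¹` presents
  `Γ(w)`;
* `NashStipsicz.invY`, `NashStipsicz.presentedGroupCongrInvY` — the automorphism `y ↦ y⁻¹` of `F₂`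
  and the induced isomorphism of one-relator groups;
* `NashStipsicz.groupOEEquiv`, `NashStipsicz.groupEEEquiv`, `NashStipsicz.groupEOEquiv` — the three
  isomorphisms with disc groups.

Reference: Nash–Stipsicz, arXiv:1103.5571, Proposition 4.2 (p. 6 of the arXiv version).
-/

namespace Summit.SmoothPoincare4.SmoothPoincare4.Theorems

namespace NashStipsicz

/-! ### Two general lemmas on one-relator presentations -/

/-- In any group the normal closures of `g r⁻¹ g⁻¹` and of `r` coincide. -/
theorem normalClosure_conj_inv_singleton {G : Type*} [Group G] (g r : G) :
    Subgroup.normalClosure ({g * r⁻¹ * g⁻¹} : Set G) = Subgroup.normalClosure {r} := by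
  apply le_antisymm
  · apply Subgroup.normalClosure_le_normal
    intro x hx
    rw [Set.mem_singleton_iff] at hx
    subst hx
    have h : r ∈ Subgroup.normalClosure ({r} : Set G) :=
      Subgroup.subset_normalClosure (Set.mem_singleton _)
    rw [SetLike.mem_coe]
    exact Subgroup.normalClosure_normal.conj_mem _ (inv_mem h) _
  · apply Subgroup.normalClosure_le_normal
    intro x hx
    rw [Set.mem_singleton_iff] at hx
    subst hx
    have h : g * x⁻¹ * g⁻¹ ∈ Subgroup.normalClosure ({g * x⁻¹ * g⁻¹} : Set G) :=
      Subgroup.subset_normalClosure (Set.mem_singleton _)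
    have h3 : g⁻¹ * (g * x⁻¹ * g⁻¹)⁻¹ * g⁻¹⁻¹ ∈ Subgroup.normalClosure ({g * x⁻¹ * g⁻¹} : Set G) :=
      Subgroup.normalClosure_normal.conj_mem _ (inv_mem h) _
    have h4 : g⁻¹ * (g * x⁻¹ * g⁻¹)⁻¹ * g⁻¹⁻¹ = x := by group
    rw [h4] at h3
    exact h3

/-- The normal closure of a relator of the shape `x · (x⁻¹ w y w⁻¹)⁻¹ · x⁻¹` is that of the disc
relator `x⁻¹ w y w⁻¹` of `w`. -/
theorem normalClosure_eq_of_eq_conj_inv_discRelator (r w : FreeGroup (Fin 2))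
    (h : r = FreeGroup.of 0 * (FusionOne.discRelator w)⁻¹ * (FreeGroup.of 0)⁻¹) :
    Subgroup.normalClosure ({r} : Set (FreeGroup (Fin 2))) =
      Subgroup.normalClosure ({FusionOne.discRelator w} : Set (FreeGroup (Fin 2))) := by
  rw [h, normalClosure_conj_inv_singleton]

/-- **A one-relator group `⟨x, y | r⟩` with `r = x (x⁻¹ w y w⁻¹)⁻¹ x⁻¹` is the disc group
`Γ(w) = ⟨x, y | x = w y w⁻¹⟩`** (the identity on generators induces the isomorphism). -/
def equivDiscGroupOfEq (r w : FreeGroup (Fin 2))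
    (h : r = FreeGroup.of 0 * (FusionOne.discRelator w)⁻¹ * (FreeGroup.of 0)⁻¹) :
    PresentedGroup ({r} : Set (FreeGroup (Fin 2))) ≃* FusionOne.DiscGroup w :=
  QuotientGroup.quotientMulEquivOfEq (normalClosure_eq_of_eq_conj_inv_discRelator r w h)

/-- `equivDiscGroupOfEq` is the identity on generators. -/
theorem equivDiscGroupOfEq_of (r w : FreeGroup (Fin 2))
    (h : r = FreeGroup.of 0 * (FusionOne.discRelator w)⁻¹ * (FreeGroup.of 0)⁻¹) (i : Fin 2) :
    equivDiscGroupOfEq r w h (PresentedGroup.of i) = PresentedGroup.of i := rfl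

/-! ### The automorphism `y ↦ y⁻¹` -/

/-- The endomorphism `x ↦ x`, `y ↦ y⁻¹` of the free group `F₂ = F(x, y)`. -/
def invYHom : FreeGroup (Fin 2) →* FreeGroup (Fin 2) :=
  FreeGroup.lift ![FreeGroup.of 0, (FreeGroup.of 1)⁻¹]

/-- `invYHom x = x`. -/
@[simp] theorem invYHom_of_zero : invYHom (FreeGroup.of 0) = FreeGroup.of 0 := by
  simp [invYHom]

/-- `invYHom y = y⁻¹`. -/
@[simp] theorem invYHom_of_one : invYHom (FreeGroup.of 1) = (FreeGroup.of 1)⁻¹ := by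
  simp [invYHom]

/-- `invYHom` is an involution. -/
theorem invYHom_comp_invYHom : invYHom.comp invYHom = MonoidHom.id _ := by
  ext i
  fin_cases i <;> simp

/-- The automorphism `x ↦ x`, `y ↦ y⁻¹` of `F₂`. -/
def invY : FreeGroup (Fin 2) ≃* FreeGroup (Fin 2) :=
  MonoidHom.toMulEquiv invYHom invYHom invYHom_comp_invYHom invYHom_comp_invYHom

/-- `invY` is `invYHom` as a function. -/
@[simp] theorem invY_apply (g : FreeGroup (Fin 2)) : invY g = invYHom g := rfl

/-- **Substituting `y ↦ y⁻¹` in a one-relator presentation gives an isomorphic group.** -/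
def presentedGroupCongrInvY (r : FreeGroup (Fin 2)) :
    PresentedGroup ({r} : Set (FreeGroup (Fin 2))) ≃*
      PresentedGroup ({invY r} : Set (FreeGroup (Fin 2))) :=
  QuotientGroup.congr (Subgroup.normalClosure ({r} : Set (FreeGroup (Fin 2))))
    (Subgroup.normalClosure ({invY r} : Set (FreeGroup (Fin 2)))) invY (by
      rw [Subgroup.map_normalClosure _ _ (fun g => ⟨invY.symm g, invY.apply_symm_apply g⟩),
        Set.image_singleton]
      rfl)

/-! ### The four relators and their band words -/

/-- `r_ee = x y x y⁻¹ x⁻¹ y x y x⁻¹ y⁻¹` (`p, q` even). -/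
def relEE : FreeGroup (Fin 2) :=
  FreeGroup.of 0 * FreeGroup.of 1 * FreeGroup.of 0 * (FreeGroup.of 1)⁻¹ * (FreeGroup.of 0)⁻¹ *
    FreeGroup.of 1 * FreeGroup.of 0 * FreeGroup.of 1 * (FreeGroup.of 0)⁻¹ * (FreeGroup.of 1)⁻¹

/-- `r_oe = x y x y⁻¹ x⁻¹ y⁻¹ x y x⁻¹ y⁻¹` (`p` odd, `q` even). -/
def relOE : FreeGroup (Fin 2) :=
  FreeGroup.of 0 * FreeGroup.of 1 * FreeGroup.of 0 * (FreeGroup.of 1)⁻¹ * (FreeGroup.of 0)⁻¹ *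
    (FreeGroup.of 1)⁻¹ * FreeGroup.of 0 * FreeGroup.of 1 * (FreeGroup.of 0)⁻¹ * (FreeGroup.of 1)⁻¹

/-- `r_eo = x y x y x⁻¹ y x y⁻¹ x⁻¹ y⁻¹` (`p` even, `q` odd). -/
def relEO : FreeGroup (Fin 2) :=
  FreeGroup.of 0 * FreeGroup.of 1 * FreeGroup.of 0 * FreeGroup.of 1 * (FreeGroup.of 0)⁻¹ *
    FreeGroup.of 1 * FreeGroup.of 0 * (FreeGroup.of 1)⁻¹ * (FreeGroup.of 0)⁻¹ * (FreeGroup.of 1)⁻¹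

/-- The odd–odd relator `r_oo` is `NashStipsicz.nsRelator`. -/
theorem relOO_eq_nsRelator :
    FreeGroup.of 0 * FreeGroup.of 1 * FreeGroup.of 0 * FreeGroup.of 1 * (FreeGroup.of 0)⁻¹ *
      (FreeGroup.of 1)⁻¹ * FreeGroup.of 0 * (FreeGroup.of 1)⁻¹ * (FreeGroup.of 0)⁻¹ *
      (FreeGroup.of 1)⁻¹ = nsRelator := rfl

/-- The band word `[y, x] = y x y⁻¹ x⁻¹` (`p` odd). -/
def bandA : FreeGroup (Fin 2) :=
  FreeGroup.of 1 * FreeGroup.of 0 * (FreeGroup.of 1)⁻¹ * (FreeGroup.of 0)⁻¹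

/-- The band word `y⁻¹ x y x⁻¹` (image of `[y, x]` under `y ↦ y⁻¹`). -/
def bandA' : FreeGroup (Fin 2) :=
  (FreeGroup.of 1)⁻¹ * FreeGroup.of 0 * FreeGroup.of 1 * (FreeGroup.of 0)⁻¹

/-- The band word `y⁻¹ x y⁻¹ x⁻¹` (image of `y x y x⁻¹` under `y ↦ y⁻¹`). -/
def bandB' : FreeGroup (Fin 2) :=
  (FreeGroup.of 1)⁻¹ * FreeGroup.of 0 * (FreeGroup.of 1)⁻¹ * (FreeGroup.of 0)⁻¹

/-- `r_oe = x · (x⁻¹ w y w⁻¹)⁻¹ · x⁻¹` with `w = [y, x]`. -/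
theorem relOE_eq : relOE =
    FreeGroup.of 0 * (FusionOne.discRelator bandA)⁻¹ * (FreeGroup.of 0)⁻¹ := by
  simp only [relOE, FusionOne.discRelator, bandA]
  group

/-- `invY r_ee = x · (x⁻¹ w y w⁻¹)⁻¹ · x⁻¹` with `w = y⁻¹ x y x⁻¹`. -/
theorem invY_relEE : invY relEE =
    FreeGroup.of 0 * (FusionOne.discRelator bandA')⁻¹ * (FreeGroup.of 0)⁻¹ := by
  simp only [invY_apply, relEE, map_mul, map_inv, invYHom_of_zero, invYHom_of_one,
    FusionOne.discRelator, bandA']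
  group

/-- `invY r_eo = x · (x⁻¹ w y w⁻¹)⁻¹ · x⁻¹` with `w = y⁻¹ x y⁻¹ x⁻¹`. -/
theorem invY_relEO : invY relEO =
    FreeGroup.of 0 * (FusionOne.discRelator bandB')⁻¹ * (FreeGroup.of 0)⁻¹ := by
  simp only [invY_apply, relEO, map_mul, map_inv, invYHom_of_zero, invYHom_of_one,
    FusionOne.discRelator, bandB']
  group

/-! ### The three isomorphisms -/

/-- **`⟨x, y | r_oe⟩ ≃* Γ([y, x])`** (`p` odd, `q` even). -/
def groupOEEquiv :
    PresentedGroup ({relOE} : Set (FreeGroup (Fin 2))) ≃* FusionOne.DiscGroup bandA :=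
  equivDiscGroupOfEq relOE bandA relOE_eq

/-- **`⟨x, y | r_ee⟩ ≃* Γ(y⁻¹ x y x⁻¹)`** (`p, q` even; via `y ↦ y⁻¹`). -/
def groupEEEquiv :
    PresentedGroup ({relEE} : Set (FreeGroup (Fin 2))) ≃* FusionOne.DiscGroup bandA' :=
  (presentedGroupCongrInvY relEE).trans (equivDiscGroupOfEq (invY relEE) bandA' invY_relEE)

/-- **`⟨x, y | r_eo⟩ ≃* Γ(y⁻¹ x y⁻¹ x⁻¹)`** (`p` even, `q` odd; via `y ↦ y⁻¹`). -/
def groupEOEquiv :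
    PresentedGroup ({relEO} : Set (FreeGroup (Fin 2))) ≃* FusionOne.DiscGroup bandB' :=
  (presentedGroupCongrInvY relEO).trans (equivDiscGroupOfEq (invY relEO) bandB' invY_relEO)

/-- Summary: each of the three Nash–Stipsicz groups `⟨x, y | r_ee⟩`, `⟨x, y | r_oe⟩`, `⟨x, y | r_eo⟩`
is isomorphic to a fusion-number-one disc group `Γ(w)`. -/
theorem nonempty_mulEquiv_discGroup :
    Nonempty (PresentedGroup ({relEE} : Set (FreeGroup (Fin 2))) ≃* FusionOne.DiscGroup bandA') ∧
      Nonempty (PresentedGroup ({relOE} : Set (FreeGroup (Fin 2))) ≃* FusionOne.DiscGroup bandA) ∧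
      Nonempty (PresentedGroup ({relEO} : Set (FreeGroup (Fin 2))) ≃* FusionOne.DiscGroup bandB') :=
  ⟨⟨groupEEEquiv⟩, ⟨groupOEEquiv⟩, ⟨groupEOEquiv⟩⟩

end NashStipsicz

end Summit.SmoothPoincare4.SmoothPoincare4.Theorems
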